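import Summits.ValiantsHypothesis.ValiantsHypothesis.Theorems.GeneratorObstructionsPerGenDegreeSuperQPFaceLayers

/-!
# Route GeneratorObstructions — K1 `PerGenDegreeSuperQP` (stmt-ValiantsHypothesis-11654),
# line `per-side-atoms`: RESIDUE ATOMS on the constant ray — every late atom of the degree
# semigroup `E(per_m)` is a late atom of `S(per_m)`

Companion of `…FaceLayers` (face layers start with an atom) and `…MinimalDegree` (the FIRST
constant occurring weight `-k₀𝟙`, `k₀ m = e(per_m)`, is an atom; `stub_atomLate` ⇐ `e(per_m)`
super-quasi-polynomial infinitely often). The constant occurring weights `-k𝟙` of `ℂ[Δ_m[per_m]]`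
form the constant face of `S(per_m)`; the set of their levels `k` is Bürgisser–Ikenmeyer's DEGREE
SEMIGROUP `E(per_m) = {k : some SL_{m²}-invariant of degree k m does not vanish at per_m}`
(`…MinimalDegree`). Since a constant weight splits inside `S(per_m)` only into constant weights
(dominance, `…FaceLayers.isBlockConstant_face`), EVERY atom of the numerical semigroup `E(per_m)`
— not only its least element — gives an atom `-k𝟙` of `S(per_m)`, of degree `k m`. This file
records the layer form of that remark:

* `exists_atom_constant_of_not_additive` — for any polynomial `f`, index `i₀` and ADDITIVE
  predicate `T` on `ℤ` (`T a → T b → T (a + b)`; e.g. `r ∣ a`, or membership in the submonoid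
  generated by the early levels): if some constant occurring weight `χ` has `¬ T (χ i₀)`, then
  the least-degree such weight is an ATOM of `S(f)` (`exists_atom_of_layer` with `P` = constant,
  `R χ = T (χ i₀)`).
* `per_exists_atom_constant_of_not_additive` — the permanent instance.
* `stub_atomLate_of_lateConstantResidue` — the registered `stub_atomLate` VERBATIM from: for
  every `c` and infinitely many `m` there is an additive `T` such that some constant occurring
  weight of `ℂ[Δ_m[per_m]]` lies outside `T` and every constant occurring weight outside `T` has
  degree `> 2^((log₂ m + c)^c)`. With `T` = "level in the submonoid generated by
  `E(per_m) ∩ [0, 2^((log₂ m + c)^c)]`" this reads: **`stub_atomLate` ⇐ the degree semigroup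
  `E(per_m)` is not generated in quasi-polynomial degree for infinitely many `m`** — a statement
  about which degrees of `SL_{m²}`-invariants detect `per_m` (BI17 §3), strictly weaker than the
  `…MinimalDegree` hypothesis on `e(per_m)` alone (which is polynomial, `= m²`, whenever BI17's
  fundamental invariant does not vanish at `per_m`, e.g. `m = 2, 4`).

Honest framing: a specialisation of the face-layer principle; no bound on `E(per_m)` is proved;
`stub_atomLate` (for `c ≥ 2`), K1 and `GenFlipThesis` remain OPEN; nothing here bears on VP
versus VNP. References: [BurgisserIkenmeyer2017] §3.3 (degree monoid, `e(per_m) ≥ m²`,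
stabiliser period) as background only. [folklore]
-/

set_option linter.dupNamespace false

namespace Summit.ValiantsHypothesis.ValiantsHypothesis.Theorems.GeneratorObstructions.PerGenDegreeSuperQP

open MvPolynomial
open Literature.NumberTheory.DiophantineGeometry Literature.Computability.AlgebraicComplexity
  Literature.Computability.Complexity

/-! ### 1. Constant weights outside an additive class of levels -/

section Layer

variable {σ : Type*} [Fintype σ] [LinearOrder σ]

/-- **Constancy is facial** for the occurrence monoid of `ℂ[Δ_n[f]]`: two occurring weights whose
sum is constant are both constant (the one-block case of `isBlockConstant_face`). [folklore] -/
theorem isConstant_face (f : MvPolynomial σ ℂ) (n : ℕ) :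
    ∀ χ₁ χ₂ : Weight σ, highestWeightSpace (orbitCoordRep f n) χ₁ ≠ ⊥ →
      highestWeightSpace (orbitCoordRep f n) χ₂ ≠ ⊥ →
      (∀ a b : σ, (χ₁ + χ₂) a = (χ₁ + χ₂) b) →
      (∀ a b : σ, χ₁ a = χ₁ b) ∧ (∀ a b : σ, χ₂ a = χ₂ b) := by
  intro χ₁ χ₂ h1 h2 h
  have key := isBlockConstant_face f n (fun _ : σ => (0 : ℕ)) χ₁ χ₂ h1 h2 (fun a b _ => h a b)
  exact ⟨fun a b => key.1 a b rfl, fun a b => key.2 a b rfl⟩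

/-- **Residue atoms on the constant face.** Let `T` be an additive predicate on `ℤ` and `i₀` an
index. If some CONSTANT weight occurring in `ℂ[Δ_n[f]]` has its value outside `T`, then the
least-degree constant occurring weight with value outside `T` exists and is an ATOM of the
occurrence monoid: constancy is facial (`isConstant_face`) and "value in `T`" is additive, so
`exists_atom_of_layer` applies. (For `f = per_m`: every atom of the degree semigroup `E(per_m)`
outside the sub-semigroup `T` is an atom of `S(per_m)`.) [folklore] -/
theorem exists_atom_constant_of_not_additive (f : MvPolynomial σ ℂ) (n : ℕ) (i₀ : σ)
    (T : ℤ → Prop) (hT : ∀ a b : ℤ, T a → T b → T (a + b))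
    (hex : ∃ χ : Weight σ, highestWeightSpace (orbitCoordRep f n) χ ≠ ⊥ ∧
      (∀ a b : σ, χ a = χ b) ∧ ¬ T (χ i₀)) :
    ∃ χ : Weight σ, highestWeightSpace (orbitCoordRep f n) χ ≠ ⊥ ∧
      (∀ a b : σ, χ a = χ b) ∧ ¬ T (χ i₀) ∧
      (∀ ψ : Weight σ, highestWeightSpace (orbitCoordRep f n) ψ ≠ ⊥ →
        (∀ a b : σ, ψ a = ψ b) → ¬ T (ψ i₀) → ψ.size ≤ χ.size) ∧
      (∀ χ₁ χ₂ : Weight σ, χ₁ + χ₂ = χ → χ₁ ≠ 0 → χ₂ ≠ 0 →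
        highestWeightSpace (orbitCoordRep f n) χ₁ = ⊥ ∨
          highestWeightSpace (orbitCoordRep f n) χ₂ = ⊥) :=
  exists_atom_of_layer f n (fun χ => ∀ a b : σ, χ a = χ b) (fun χ => T (χ i₀))
    (isConstant_face f n)
    (fun χ₁ χ₂ _ _ _ _ hR1 hR2 => by
      simpa only [Pi.add_apply] using hT _ _ hR1 hR2)
    hex

end Layer

/-! ### 2. The permanent: late residue atoms of `E(per_m)` give `stub_atomLate` -/

section Permanent

variable {m : ℕ}

/-- **Residue atoms of `S(per_m)`** (permanent instance of
`exists_atom_constant_of_not_additive`): for an additive predicate `T` on `ℤ` and an index `i₀`,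
if some constant occurring weight of `ℂ[Δ_m[per_m]]` has value outside `T`, the least-degree such
weight is an occurring ATOM. [folklore] -/
theorem per_exists_atom_constant_of_not_additive (i₀ : MatIdx m) (T : ℤ → Prop)
    (hT : ∀ a b : ℤ, T a → T b → T (a + b))
    (hex : ∃ χ : Weight (MatIdx m),
      highestWeightSpace (orbitCoordRep (MvPolynomial.rename toLex (perPoly (Fin m) ℂ)) m) χ ≠ ⊥ ∧
      (∀ a b : MatIdx m, χ a = χ b) ∧ ¬ T (χ i₀)) :
    ∃ χ : Weight (MatIdx m),
      highestWeightSpace (orbitCoordRep (MvPolynomial.rename toLex (perPoly (Fin m) ℂ)) m) χ ≠ ⊥ ∧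
      (∀ a b : MatIdx m, χ a = χ b) ∧ ¬ T (χ i₀) ∧
      (∀ ψ : Weight (MatIdx m),
        highestWeightSpace (orbitCoordRep (MvPolynomial.rename toLex (perPoly (Fin m) ℂ)) m) ψ ≠ ⊥ →
        (∀ a b : MatIdx m, ψ a = ψ b) → ¬ T (ψ i₀) → ψ.size ≤ χ.size) ∧
      (∀ χ₁ χ₂ : Weight (MatIdx m), χ₁ + χ₂ = χ → χ₁ ≠ 0 → χ₂ ≠ 0 →
        highestWeightSpace (orbitCoordRep (MvPolynomial.rename toLex (perPoly (Fin m) ℂ)) m) χ₁ = ⊥ ∨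
          highestWeightSpace (orbitCoordRep (MvPolynomial.rename toLex (perPoly (Fin m) ℂ)) m) χ₂ = ⊥) :=
  exists_atom_constant_of_not_additive _ m i₀ T hT hex

/-- **Late residue atoms of the degree semigroup give `stub_atomLate`.** Suppose that for every
`c, m₀` there are `m ≥ max(m₀, 1)`, an index `i₀ : MatIdx m` and an ADDITIVE predicate `T` on `ℤ`
such that (i) some constant weight occurring in `ℂ[Δ_m[per_m]]` has value outside `T`, and
(ii) every constant occurring weight with value outside `T` has degree `-|χ|/m > 2^((log₂ m + c)^c)`.
Then the registered `stub_atomLate` holds VERBATIM (the least-degree such weight is an atom,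
`per_exists_atom_constant_of_not_additive`). With `T a ⟺ -a ∈ ⟨E(per_m) ∩ [0, q]⟩`
(`q = 2^((log₂ m + c)^c)`): `stub_atomLate` ⇐ BI17's degree semigroup `E(per_m)` is not generated
in quasi-polynomial degree, infinitely often; with `T a ⟺ r ∣ a`: ⇐ the least level of `E(per_m)`
prime to `r` is super-quasi-polynomial, infinitely often. [folklore] -/
theorem stub_atomLate_of_lateConstantResidue
    (H : ∀ c m₀ : ℕ, ∃ m : ℕ, m₀ ≤ m ∧ 1 ≤ m ∧ ∃ (i₀ : MatIdx m) (T : ℤ → Prop),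
      (∀ a b : ℤ, T a → T b → T (a + b)) ∧
      (∃ χ : Weight (MatIdx m),
        highestWeightSpace (orbitCoordRep (MvPolynomial.rename toLex (perPoly (Fin m) ℂ)) m) χ ≠ ⊥ ∧
        (∀ a b : MatIdx m, χ a = χ b) ∧ ¬ T (χ i₀)) ∧
      (∀ χ : Weight (MatIdx m),
        highestWeightSpace (orbitCoordRep (MvPolynomial.rename toLex (perPoly (Fin m) ℂ)) m) χ ≠ ⊥ →
        (∀ a b : MatIdx m, χ a = χ b) → ¬ T (χ i₀) →
          (m : ℤ) * 2 ^ ((Nat.log 2 m + c) ^ c) < -(Weight.size χ))) :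
    ∀ c m₀ : ℕ, ∃ m : ℕ, m₀ ≤ m ∧ 1 ≤ m ∧ ∃ χ : Weight (MatIdx m),
      highestWeightSpace (orbitCoordRep (MvPolynomial.rename toLex (perPoly (Fin m) ℂ)) m) χ ≠ ⊥ ∧
      (∀ χ₁ χ₂ : Weight (MatIdx m), χ₁ + χ₂ = χ → χ₁ ≠ 0 → χ₂ ≠ 0 →
          highestWeightSpace (orbitCoordRep (MvPolynomial.rename toLex (perPoly (Fin m) ℂ)) m) χ₁ = ⊥ ∨ highestWeightSpace (orbitCoordRep (MvPolynomial.rename toLex (perPoly (Fin m) ℂ)) m) χ₂ = ⊥) ∧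
      (m : ℤ) * 2 ^ ((Nat.log 2 m + c) ^ c) < -(Weight.size χ) := by
  intro c m₀
  obtain ⟨m, hm₀, hm1, i₀, T, hT, hex, hlate⟩ := H c m₀
  obtain ⟨χ, hχ, hconst, hnot, -, hatom⟩ := per_exists_atom_constant_of_not_additive i₀ T hT hex
  exact ⟨m, hm₀, hm1, χ, hχ, hatom, hlate χ hχ hconst hnot⟩

end Permanent

end Summit.ValiantsHypothesis.ValiantsHypothesis.Theorems.GeneratorObstructions.PerGenDegreeSuperQP
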